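import Mathlib.Analysis.SpecialFunctions.Trigonometric.Basic
import Mathlib.LinearAlgebra.Matrix.Kronecker
import Mathlib.Data.Matrix.Block
import Literature.Computability.QuantumComplexity.PolynomialMethod
import Literature.Computability.Cryptography.QubitRegisterProofs
import HarnessLib

/-!
# Straight-line quantum query programs: composition, inversion, coherent mixtures, amplitude amplification

Infrastructure over the tree's query model `Literature.Computability.Cryptography.QQueryAlg`
(`QuantumQuery.lean`: basis `Fin N × Bool × W`, oracle `O_x |i, b, z⟩ = |i, b ⊕ x_i, z⟩`, unitaries
`U₀, …, U_T` interleaved with `T` queries, Born acceptance probability), built for the proof of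
`grover_bbbv` (`QueryComplexityProofs.lean`: Grover search with an unknown number of solutions) but
stated generally. Everything here is proved; there are no named facts.

* **Programs** (`QTok`, `runTok`): a program is a list of tokens, each an input-independent unitary
  or a query; programs compose by concatenation (`runTok_append`), invert by reversal
  (`invTok`, `runTok_invTok_runTok`; the oracle is an involution), and normalise to a `QQueryAlg`
  (`toAlg`, `toAlg_finalState`, `toAlg_acceptProb`, `toAlg_queries = numQueries`).
* **Householder reflections** (`householder`, `householder_mem_unitaryGroup`,
  `householder_mulVec_single`): a unitary with a prescribed real unit column — the tree's stand-in
  for "any unitary `T'` with `T'|0⟩ = N^{-1/2} ∑ |i⟩ will do" (Boyer–Brassard–Høyer–Tapp 1998, §6).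
* **Two reflections make a rotation** (`reflect_rotate`, `reflect_rotate_iterate`): on the plane of
  orthonormal `g` ("good") and `b` ("bad"), negating the `g`-component and reflecting about
  `ψ = sin θ g + cos θ b` rotates by `2θ`, so `j` rounds send `ψ` to
  `sin((2j+1)θ) g + cos((2j+1)θ) b` — the common core of Grover's analysis (BBHT 1998, §3,
  `k_j = sin((2j+1)θ)`) and of amplitude amplification (Brassard–Høyer–Mosca–Tapp 2002, §2,
  Lemma 1 and eq. (8)).
* **Coherent mixtures** (`mixTok`, `runTok_mixTok`, `wt_liftVec`): a coin register `K` in the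
  workspace, prepared by a unitary `V` and then only used as a control, runs a family of
  uniform-shape branch programs in orthogonal blocks; the accepting weight is
  `∑_k |V_{k k₀}|² · (weight of branch k)` — the unitary rendering of "choose `j` at random"
  (BBHT 1998, §4).
* **Amplitude amplification of a program** (`aaRound l s P = S_P, l⁻¹, S'_s, l`, i.e.
  `Q = 𝒜 (2|s⟩⟨s| − 1) 𝒜⁻¹ S_P = −𝒜 S_0 𝒜⁻¹ S_χ`; `wt_aa_iterate`): if `l` prepares from `e_s` a
  state of `P`-weight `a ∈ (0,1)` then after `j` rounds the `P`-weight is `sin²((2j+1)θ_a)`,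
  `sin² θ_a = a` (BHMT 2002, §2 eq. (8)); `wt_aa_iterate_zero` for `a = 0`.

Design notes. States are plain vectors `Fin N × Bool × W → ℂ` with `Matrix.mulVec`, inner product
`star v ⬝ᵥ w` and weights `wt A v = ∑_{s ∈ A} |v s|²` (matching `QQueryAlg.acceptProb`); unitaries
are elements of `Matrix.unitaryGroup` (products, inverses, `Matrix.kronecker_mem_unitary`,
`Matrix.blockDiagonal`, and the tree's `submatrix_mem_unitaryGroup`). Mathlib has no quantum query
or amplitude-amplification material (searched `Grover`, `amplitude`, `Householder`).

## References

* M. Boyer, G. Brassard, P. Høyer, A. Tapp, *Tight bounds on quantum searching*, Fortschr. Phys. 46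
  (1998) 493–505, §3, §4, §6 (arXiv:quant-ph/9605034, read via `lit read`) [BoyerEtAl1998].
* G. Brassard, P. Høyer, M. Mosca, A. Tapp, *Quantum amplitude amplification and estimation*,
  Contemp. Math. 305 (2002) 53–74, §2 (the operator `Q = −𝒜 S_0 𝒜⁻¹ S_χ`, Lemma 1, eq. (8))
  (arXiv:quant-ph/0005055, read via `lit read`) [BrassardEtAl2002].
* R. Beals, H. Buhrman, R. Cleve, M. Mosca, R. de Wolf, *Quantum lower bounds by polynomials*,
  J. ACM 48 (2001), §2 (the query model) [BealsEtAl2001].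
-/

noncomputable section

namespace Literature.Computability.QuantumComplexity.QProg

open Matrix Finset Literature.Computability.Cryptography
open scoped Kronecker

/-! ### Householder reflections: a unitary with a prescribed real column -/

section Householder

variable {ι : Type*} [Fintype ι] [DecidableEq ι]

/-- The Householder vector `w = c - e_{k₀}`. [folklore] -/
def hhVec (c : ι → ℝ) (k₀ : ι) : ι → ℝ := fun i => c i - if i = k₀ then 1 else 0

/-- The real Householder matrix `1 - (2/‖w‖²) w wᵀ`, `w = c - e_{k₀}` (the identity when
`w = 0`, since `2 / 0 = 0`). [folklore] -/
def hhReal (c : ι → ℝ) (k₀ : ι) : Matrix ι ι ℝ :=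
  1 - (2 / ∑ l, hhVec c k₀ l ^ 2) • vecMulVec (hhVec c k₀) (hhVec c k₀)

/-- The Householder matrix as a complex matrix. [folklore] -/
def householder (c : ι → ℝ) (k₀ : ι) : Matrix ι ι ℂ :=
  (hhReal c k₀).map (algebraMap ℝ ℂ)

omit [DecidableEq ι] in
/-- `w ⬝ᵥ w = ∑ w_l²` for a real vector. [folklore] -/
theorem dotProduct_self_eq_sum_sq (w : ι → ℝ) : w ⬝ᵥ w = ∑ l, w l ^ 2 := by
  simp [dotProduct, sq]

/-- `H_ℝ · H_ℝ = 1`. [folklore] -/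
theorem hhReal_mul_self (c : ι → ℝ) (k₀ : ι) : hhReal c k₀ * hhReal c k₀ = 1 := by
  set w := hhVec c k₀ with hw
  set nw : ℝ := ∑ l, w l ^ 2 with hnw
  set a : ℝ := 2 / nw with ha_def
  have hP : vecMulVec w w * vecMulVec w w = nw • vecMulVec w w := by
    rw [vecMulVec_mul_vecMulVec, dotProduct_self_eq_sum_sq]
    ext i j
    simp [vecMulVec_apply]
    ring
  have ha : a * a * nw = a + a := by
    by_cases h : nw = 0
    · simp [ha_def, h]
    · rw [ha_def]
      field_simp
      ring
  have h1 : hhReal c k₀ = 1 - a • vecMulVec w w := rfl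
  rw [h1, sub_mul, one_mul, mul_sub, mul_one, smul_mul_smul_comm, hP, smul_smul, ha, add_smul]
  abel

/-- `H_ℝ` is symmetric. [folklore] -/
theorem hhReal_transpose (c : ι → ℝ) (k₀ : ι) : (hhReal c k₀)ᵀ = hhReal c k₀ := by
  simp only [hhReal, transpose_sub, transpose_one, transpose_smul, transpose_vecMulVec]

/-- The Householder matrix is Hermitian. [folklore] -/
theorem householder_conjTranspose (c : ι → ℝ) (k₀ : ι) :
    (householder c k₀)ᴴ = householder c k₀ := by
  ext i j
  have h := congrFun (congrFun (hhReal_transpose c k₀) i) j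
  rw [transpose_apply] at h
  simp only [householder, conjTranspose_apply, map_apply, h]
  simp

/-- The Householder matrix is unitary. [folklore] -/
theorem householder_mem_unitaryGroup (c : ι → ℝ) (k₀ : ι) :
    householder c k₀ ∈ Matrix.unitaryGroup ι ℂ := by
  rw [Matrix.mem_unitaryGroup_iff, star_eq_conjTranspose, householder_conjTranspose]
  unfold householder
  rw [← Matrix.map_mul, hhReal_mul_self]
  simp

/-- Entries of the real Householder matrix. [folklore] -/
theorem hhReal_apply (c : ι → ℝ) (k₀ : ι) (i j : ι) :
    hhReal c k₀ i j = (if i = j then 1 else 0) -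
      2 / (∑ l, hhVec c k₀ l ^ 2) * hhVec c k₀ i * hhVec c k₀ j := by
  simp only [hhReal, Matrix.sub_apply, Matrix.one_apply, Matrix.smul_apply, vecMulVec_apply,
    smul_eq_mul]
  ring

/-- If the real vector `c` is a unit vector, the Householder matrix maps `e_{k₀}` to `c`.
[folklore] -/
theorem householder_mulVec_single {c : ι → ℝ} (hc : ∑ l, c l ^ 2 = 1) (k₀ : ι) :
    householder c k₀ *ᵥ Pi.single k₀ 1 = fun i => (c i : ℂ) := by
  set w := hhVec c k₀ with hw
  set nw : ℝ := ∑ l, w l ^ 2 with hnw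
  -- `nw = -2 w_{k₀}`
  have hwk : ∀ l, w l = c l - if l = k₀ then 1 else 0 := fun l => rfl
  have hnw' : nw = -2 * w k₀ := by
    have h1 : ∀ l, w l ^ 2 = c l ^ 2 - 2 * (if l = k₀ then c l else 0) +
        (if l = k₀ then 1 else 0) := fun l => by
      rw [hwk]; split_ifs <;> ring
    rw [hnw, Finset.sum_congr rfl fun l _ => h1 l, Finset.sum_add_distrib, Finset.sum_sub_distrib,
      ← Finset.mul_sum, Finset.sum_ite_eq' Finset.univ k₀, Finset.sum_ite_eq' Finset.univ k₀, hc,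
      hwk k₀]
    simp
    ring
  funext i
  rw [mulVec_single_one]
  simp only [col_apply, householder, map_apply, hhReal_apply]
  rw [← hw, ← hnw]
  by_cases h0 : w k₀ = 0
  · -- then `nw = 0`, so `w = 0` and `c = e_{k₀}`
    have hnw0 : nw = 0 := by rw [hnw', h0]; ring
    have hwz : ∀ l, w l = 0 := fun l => by
      have := (Finset.sum_eq_zero_iff_of_nonneg (fun l _ => sq_nonneg (w l))).1 hnw0 l
        (Finset.mem_univ l)
      exact (pow_eq_zero_iff (n := 2) (by norm_num)).1 this
    have hci : c i = if i = k₀ then 1 else 0 := by have := hwz i; rw [hwk] at this; linarith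
    rw [hci, hwz i]
    simp only [Complex.coe_algebraMap]
    push_cast
    ring
  · have hcoef : 2 / nw * w i * w k₀ = -w i := by
      rw [hnw']
      field_simp
    rw [hcoef]
    have hci : c i = (if i = k₀ then 1 else 0) + w i := by rw [hwk]; ring
    rw [hci]
    simp only [Complex.coe_algebraMap]
    push_cast
    ring

end Householder

/-! ### Straight-line query programs (tokens) -/

section Tokens

variable {N : ℕ} {W : Type} [Fintype W] [DecidableEq W]

/-- A token of a straight-line quantum query program on the basis `Fin N × Bool × W`: an
input-independent unitary, or a query to the oracle. [folklore] -/
inductive QTok (N : ℕ) (W : Type) [Fintype W] [DecidableEq W] where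
  | gate (V : Matrix.unitaryGroup (Fin N × Bool × W) ℂ)
  | query

namespace QTok

/-- The matrix of a token on input `x`. [folklore] -/
def mat (x : Fin N → Bool) : QTok N W → Matrix (Fin N × Bool × W) (Fin N × Bool × W) ℂ
  | gate V => (V : Matrix _ _ ℂ)
  | query => queryOracle x

/-- The inverse token (`O_x` is an involution). [folklore] -/
def inv : QTok N W → QTok N W
  | gate V => gate V⁻¹
  | query => query

/-- Token matrices are unitary. [folklore] -/
theorem mat_mem_unitaryGroup (x : Fin N → Bool) :
    ∀ t : QTok N W, t.mat x ∈ Matrix.unitaryGroup (Fin N × Bool × W) ℂ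
  | gate V => V.2
  | query => queryOracle_mem_unitaryGroup x

/-- Inverting a token twice gives it back. [folklore] -/
@[simp] theorem inv_inv : ∀ t : QTok N W, t.inv.inv = t
  | gate V => by simp [inv]
  | query => rfl

/-- The matrix of the inverse token is the adjoint. [folklore] -/
theorem mat_inv (x : Fin N → Bool) : ∀ t : QTok N W, (t.inv).mat x = (t.mat x)ᴴ
  | gate V => by simp [inv, mat, Matrix.UnitaryGroup.inv_val, star_eq_conjTranspose]
  | query => by
    simp only [inv, mat, queryOracle, Matrix.conjTranspose_permMatrix, queryPerm_inv]

end QTok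

/-- Running a token list (head applied first) on a state. [folklore] -/
def runTok (x : Fin N → Bool) (l : List (QTok N W)) (ψ : Fin N × Bool × W → ℂ) :
    Fin N × Bool × W → ℂ :=
  l.foldl (fun φ t => t.mat x *ᵥ φ) ψ

/-- The empty program does nothing. [folklore] -/
@[simp] theorem runTok_nil (x : Fin N → Bool) (ψ : Fin N × Bool × W → ℂ) : runTok x [] ψ = ψ := rfl

/-- Running `t :: l` applies `t` first. [folklore] -/
@[simp] theorem runTok_cons (x : Fin N → Bool) (t : QTok N W) (l : List (QTok N W))
    (ψ : Fin N × Bool × W → ℂ) : runTok x (t :: l) ψ = runTok x l (t.mat x *ᵥ ψ) := rfl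

/-- Running a concatenation runs the two programs in sequence. [folklore] -/
theorem runTok_append (x : Fin N → Bool) (l₁ l₂ : List (QTok N W)) (ψ : Fin N × Bool × W → ℂ) :
    runTok x (l₁ ++ l₂) ψ = runTok x l₂ (runTok x l₁ ψ) := by
  simp [runTok, List.foldl_append]

/-- The matrix of a token list. [folklore] -/
def tokMatrix (x : Fin N → Bool) : List (QTok N W) → Matrix (Fin N × Bool × W) (Fin N × Bool × W) ℂ
  | [] => 1
  | t :: l => tokMatrix x l * t.mat x

/-- Running a program is multiplication by its matrix. [folklore] -/
theorem runTok_eq_mulVec (x : Fin N → Bool) :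
    ∀ (l : List (QTok N W)) (ψ : Fin N × Bool × W → ℂ), runTok x l ψ = tokMatrix x l *ᵥ ψ
  | [], ψ => by simp [tokMatrix]
  | t :: l, ψ => by rw [runTok_cons, runTok_eq_mulVec x l, tokMatrix, Matrix.mulVec_mulVec]

/-- The matrix of a concatenation is the product (second factor first). [folklore] -/
theorem tokMatrix_append (x : Fin N → Bool) :
    ∀ l₁ l₂ : List (QTok N W), tokMatrix x (l₁ ++ l₂) = tokMatrix x l₂ * tokMatrix x l₁
  | [], l₂ => by simp [tokMatrix]
  | t :: l₁, l₂ => by rw [List.cons_append, tokMatrix, tokMatrix, tokMatrix_append x l₁ l₂, mul_assoc]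

/-- Program matrices are unitary. [folklore] -/
theorem tokMatrix_mem_unitaryGroup (x : Fin N → Bool) :
    ∀ l : List (QTok N W), tokMatrix x l ∈ Matrix.unitaryGroup (Fin N × Bool × W) ℂ
  | [] => Submonoid.one_mem _
  | t :: l => Submonoid.mul_mem _ (tokMatrix_mem_unitaryGroup x l) (t.mat_mem_unitaryGroup x)

/-- Running a program preserves `∑ ‖·‖²`. [folklore] -/
theorem sum_norm_sq_runTok (x : Fin N → Bool) (l : List (QTok N W)) (ψ : Fin N × Bool × W → ℂ) :
    ∑ s, ‖runTok x l ψ s‖ ^ 2 = ∑ s, ‖ψ s‖ ^ 2 := by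
  rw [runTok_eq_mulVec, sum_norm_sq_mulVec_of_mem_unitaryGroup (tokMatrix_mem_unitaryGroup x l)]

/-- The inverse program: reversed, with inverse tokens. [folklore] -/
def invTok (l : List (QTok N W)) : List (QTok N W) := (l.map QTok.inv).reverse

/-- The inverse of the empty program. [folklore] -/
@[simp] theorem invTok_nil : invTok ([] : List (QTok N W)) = [] := rfl

/-- The inverse of `t :: l` ends with `t⁻¹`. [folklore] -/
theorem invTok_cons (t : QTok N W) (l : List (QTok N W)) : invTok (t :: l) = invTok l ++ [t.inv] := by
  simp [invTok]

/-- The inverse of a concatenation. [folklore] -/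
theorem invTok_append (l₁ l₂ : List (QTok N W)) : invTok (l₁ ++ l₂) = invTok l₂ ++ invTok l₁ := by
  simp [invTok]

/-- Inversion of programs is an involution. [folklore] -/
@[simp] theorem invTok_invTok (l : List (QTok N W)) : invTok (invTok l) = l := by
  simp [invTok, List.map_reverse, Function.comp_def]

/-- The matrix of the inverse program is the adjoint. [folklore] -/
theorem tokMatrix_invTok (x : Fin N → Bool) :
    ∀ l : List (QTok N W), tokMatrix x (invTok l) = (tokMatrix x l)ᴴ
  | [] => by simp [tokMatrix]
  | t :: l => by
    rw [invTok_cons, tokMatrix_append, tokMatrix_invTok x l]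
    simp only [tokMatrix, one_mul, Matrix.conjTranspose_mul, QTok.mat_inv]

/-- The inverse program undoes the program. [folklore] -/
theorem runTok_invTok_runTok (x : Fin N → Bool) (l : List (QTok N W)) (ψ : Fin N × Bool × W → ℂ) :
    runTok x (invTok l) (runTok x l ψ) = ψ := by
  rw [runTok_eq_mulVec, runTok_eq_mulVec, tokMatrix_invTok, Matrix.mulVec_mulVec]
  have h := Matrix.mem_unitaryGroup_iff'.1 (tokMatrix_mem_unitaryGroup x l)
  rw [star_eq_conjTranspose] at h
  rw [h, Matrix.one_mulVec]

/-- The program undoes its inverse program. [folklore] -/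
theorem runTok_runTok_invTok (x : Fin N → Bool) (l : List (QTok N W)) (ψ : Fin N × Bool × W → ℂ) :
    runTok x l (runTok x (invTok l) ψ) = ψ := by
  simpa using runTok_invTok_runTok x (invTok l) ψ

/-- The number of queries of a program. [folklore] -/
def numQueries : List (QTok N W) → ℕ
  | [] => 0
  | QTok.gate _ :: l => numQueries l
  | QTok.query :: l => numQueries l + 1

/-- Query counts add under concatenation. [folklore] -/
theorem numQueries_append : ∀ l₁ l₂ : List (QTok N W), numQueries (l₁ ++ l₂) = numQueries l₁ + numQueries l₂
  | [], l₂ => by simp [numQueries]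
  | QTok.gate _ :: l₁, l₂ => by rw [List.cons_append, numQueries, numQueries, numQueries_append]
  | QTok.query :: l₁, l₂ => by rw [List.cons_append, numQueries, numQueries, numQueries_append]; omega

/-- The inverse program makes the same number of queries. [folklore] -/
theorem numQueries_invTok : ∀ l : List (QTok N W), numQueries (invTok l) = numQueries l
  | [] => rfl
  | QTok.gate V :: l => by
    rw [invTok_cons, numQueries_append, numQueries_invTok l]; simp [QTok.inv, numQueries]
  | QTok.query :: l => by
    rw [invTok_cons, numQueries_append, numQueries_invTok l]; simp [QTok.inv, numQueries]

/-! ### From programs to `QQueryAlg`: normal form `U₀, (O, U₁), …, (O, U_T)` -/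

/-- Normal form of a program: the unitary before the first query and the list of unitaries after
each query (consecutive gates multiplied, missing gates filled with `1`). [folklore] -/
def toSeg : List (QTok N W) →
    Matrix.unitaryGroup (Fin N × Bool × W) ℂ × List (Matrix.unitaryGroup (Fin N × Bool × W) ℂ)
  | [] => (1, [])
  | QTok.gate V :: l => ((toSeg l).1 * V, (toSeg l).2)
  | QTok.query :: l => (1, (toSeg l).1 :: (toSeg l).2)

/-- Running a normal form. [folklore] -/
def runSeg (x : Fin N → Bool)
    (p : Matrix.unitaryGroup (Fin N × Bool × W) ℂ × List (Matrix.unitaryGroup (Fin N × Bool × W) ℂ))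
    (ψ : Fin N × Bool × W → ℂ) : Fin N × Bool × W → ℂ :=
  p.2.foldl (fun φ (V : Matrix.unitaryGroup (Fin N × Bool × W) ℂ) =>
    (V : Matrix (Fin N × Bool × W) (Fin N × Bool × W) ℂ) *ᵥ (queryOracle x *ᵥ φ))
    ((p.1 : Matrix (Fin N × Bool × W) (Fin N × Bool × W) ℂ) *ᵥ ψ)

/-- The normal form runs like the program. [folklore] -/
theorem runSeg_toSeg (x : Fin N → Bool) :
    ∀ (l : List (QTok N W)) (ψ : Fin N × Bool × W → ℂ), runSeg x (toSeg l) ψ = runTok x l ψ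
  | [], ψ => by simp [runSeg, toSeg]
  | QTok.gate V :: l, ψ => by
    rw [runTok_cons, ← runSeg_toSeg x l]
    simp [runSeg, toSeg, QTok.mat, Matrix.mulVec_mulVec]
  | QTok.query :: l, ψ => by
    rw [runTok_cons, ← runSeg_toSeg x l]
    simp [runSeg, toSeg, QTok.mat]

/-- The normal form has one unitary per query (after `U₀`). [folklore] -/
theorem length_toSeg : ∀ l : List (QTok N W), (toSeg l).2.length = numQueries l
  | [] => rfl
  | QTok.gate V :: l => by rw [toSeg, numQueries, length_toSeg l]
  | QTok.query :: l => by rw [toSeg, numQueries, List.length_cons, length_toSeg l]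

/-- `Fin.foldl` over `l.get` is `List.foldl`. [folklore] -/
theorem foldl_get_eq_foldl {α β : Type*} (f : α → β → α) :
    ∀ (l : List β) (init : α), Fin.foldl l.length (fun a i => f a (l.get i)) init = l.foldl f init
  | [], init => by simp
  | b :: l, init => by
    show Fin.foldl (l.length + 1) (fun a i => f a ((b :: l).get i)) init = _
    rw [Fin.foldl_succ, List.foldl_cons]
    exact foldl_get_eq_foldl f l (f init b)

/-- The query algorithm of a program, an initial basis state and a set of accepting basis
states. [folklore] -/
def toAlg (l : List (QTok N W)) (start : Fin N × Bool × W) (accept : Set (Fin N × Bool × W)) :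
    QQueryAlg N where
  W := W
  queries := (toSeg l).2.length
  unitaries := Fin.cases (toSeg l).1 (toSeg l).2.get
  start := start
  accept := accept

/-- `toAlg l` makes `numQueries l` queries. [folklore] -/
@[simp] theorem toAlg_queries (l : List (QTok N W)) (start : Fin N × Bool × W)
    (accept : Set (Fin N × Bool × W)) : (toAlg l start accept).queries = numQueries l :=
  length_toSeg l

/-- The final state of an algorithm given in normal form. [folklore] -/
theorem finalState_mk_cases (x : Fin N → Bool) (pre : Matrix.unitaryGroup (Fin N × Bool × W) ℂ)
    (steps : List (Matrix.unitaryGroup (Fin N × Bool × W) ℂ)) (start : Fin N × Bool × W)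
    (accept : Set (Fin N × Bool × W)) :
    ({ W := W, queries := steps.length, unitaries := Fin.cases pre steps.get, start := start,
        accept := accept } : QQueryAlg N).finalState x =
      steps.foldl (fun φ (V : Matrix.unitaryGroup (Fin N × Bool × W) ℂ) =>
          (V : Matrix (Fin N × Bool × W) (Fin N × Bool × W) ℂ) *ᵥ (queryOracle x *ᵥ φ))
        ((pre : Matrix (Fin N × Bool × W) (Fin N × Bool × W) ℂ) *ᵥ Pi.single start 1) := by
  unfold QQueryAlg.finalState
  simp only [Fin.cases_zero, Fin.cases_succ]
  exact foldl_get_eq_foldl (fun φ V => ((V : Matrix.unitaryGroup (Fin N × Bool × W) ℂ) :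
    Matrix (Fin N × Bool × W) (Fin N × Bool × W) ℂ) *ᵥ (queryOracle x *ᵥ φ)) steps _

/-- The final state of `toAlg l` on input `x` is the run of `l` from `e_start`. [folklore] -/
theorem toAlg_finalState (l : List (QTok N W)) (start : Fin N × Bool × W)
    (accept : Set (Fin N × Bool × W)) (x : Fin N → Bool) :
    (toAlg l start accept).finalState x = runTok x l (Pi.single start 1) := by
  rw [← runSeg_toSeg]
  exact finalState_mk_cases x (toSeg l).1 (toSeg l).2 start accept

/-- The weight of a set of basis states in a state vector, `∑_{s ∈ A} |v s|²`. [folklore] -/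
def wt {ι : Type*} [Fintype ι] (A : Set ι) (v : ι → ℂ) : ℝ :=
  open scoped Classical in ∑ s with s ∈ A, ‖v s‖ ^ 2

/-- The acceptance probability of `toAlg l` is the weight of the accepting set in the run of `l`. [folklore] -/
theorem toAlg_acceptProb (l : List (QTok N W)) (start : Fin N × Bool × W)
    (accept : Set (Fin N × Bool × W)) (x : Fin N → Bool) :
    (toAlg l start accept).acceptProb x = wt accept (runTok x l (Pi.single start 1)) := by
  unfold QQueryAlg.acceptProb wt
  rw [toAlg_finalState]
  rfl

end Tokens

/-! ### Sign diagonals and the reflection about a prepared state -/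

section Reflections

variable {N : ℕ} {W : Type} [Fintype W] [DecidableEq W]

/-- A diagonal matrix with unimodular entries is unitary. [folklore] -/
theorem diagonal_mem_unitaryGroup {ι : Type*} [Fintype ι] [DecidableEq ι] (d : ι → ℂ)
    (hd : ∀ i, star (d i) * d i = 1) : diagonal d ∈ Matrix.unitaryGroup ι ℂ := by
  rw [Matrix.mem_unitaryGroup_iff', star_eq_conjTranspose, diagonal_conjTranspose,
    diagonal_mul_diagonal]
  have : (fun i => star d i * d i) = fun _ => (1 : ℂ) := funext fun i => hd i
  rw [this, diagonal_one]

/-- The sign flip `S_P = 1 - 2Π_P` on the basis states satisfying `P`, as a unitary. [folklore] -/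
def signGate {ι : Type*} [Fintype ι] [DecidableEq ι] (P : ι → Prop) [DecidablePred P] :
    Matrix.unitaryGroup ι ℂ :=
  ⟨diagonal fun t => if P t then -1 else 1,
    diagonal_mem_unitaryGroup _ fun t => by split_ifs <;> simp⟩

/-- `S_P` negates exactly the `P`-coordinates. [folklore] -/
theorem signGate_mulVec {ι : Type*} [Fintype ι] [DecidableEq ι] (P : ι → Prop) [DecidablePred P]
    (v : ι → ℂ) : (signGate P : Matrix ι ι ℂ) *ᵥ v = fun t => if P t then -v t else v t := by
  funext t
  simp only [signGate, mulVec_diagonal]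
  split_ifs <;> simp

/-- The reflection `S'_s = 2|s⟩⟨s| - 1` about a basis state, as a unitary. [folklore] -/
def reflBasis {ι : Type*} [Fintype ι] [DecidableEq ι] (s : ι) : Matrix.unitaryGroup ι ℂ :=
  ⟨diagonal fun t => if t = s then 1 else -1,
    diagonal_mem_unitaryGroup _ fun t => by split_ifs <;> simp⟩

/-- `S'_s v = 2 v_s e_s − v`. [folklore] -/
theorem reflBasis_mulVec {ι : Type*} [Fintype ι] [DecidableEq ι] (s : ι) (v : ι → ℂ) :
    (reflBasis s : Matrix ι ι ℂ) *ᵥ v = (2 * v s) • Pi.single s (1 : ℂ) - v := by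
  funext t
  simp only [reflBasis, mulVec_diagonal, Pi.sub_apply, Pi.smul_apply, smul_eq_mul]
  by_cases h : t = s
  · subst h; simp; ring
  · simp [h]

/-- `(Mᴴ v)_s = ⟨M e_s, v⟩`. [folklore] -/
theorem conjTranspose_mulVec_apply_eq {ι : Type*} [Fintype ι] [DecidableEq ι] (M : Matrix ι ι ℂ)
    (v : ι → ℂ) (s : ι) : (Mᴴ *ᵥ v) s = star (M *ᵥ Pi.single s 1) ⬝ᵥ v := by
  rw [mulVec_single_one]
  simp [mulVec, dotProduct, conjTranspose_apply]

/-- **The reflection about the prepared state**: running `𝒜⁻¹`, then `S'_s = 2|s⟩⟨s| − 1`, then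
`𝒜` acts as `v ↦ 2⟨ψ, v⟩ ψ − v` with `ψ = 𝒜 e_s` (the operator `𝒜 S'_s 𝒜⁻¹ = 2|ψ⟩⟨ψ| − 1` of
amplitude amplification). [folklore] -/
theorem runTok_reflBasis_invTok (x : Fin N → Bool) (l : List (QTok N W)) (s : Fin N × Bool × W)
    (v : Fin N × Bool × W → ℂ) :
    runTok x l ((reflBasis s : Matrix _ _ ℂ) *ᵥ runTok x (invTok l) v) =
      (2 * (star (runTok x l (Pi.single s 1)) ⬝ᵥ v)) • runTok x l (Pi.single s 1) - v := by
  rw [runTok_eq_mulVec, runTok_eq_mulVec, runTok_eq_mulVec, tokMatrix_invTok, reflBasis_mulVec,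
    mulVec_sub, mulVec_smul, mulVec_mulVec, conjTranspose_mulVec_apply_eq]
  have h := Matrix.mem_unitaryGroup_iff.1 (tokMatrix_mem_unitaryGroup x l)
  rw [star_eq_conjTranspose] at h
  rw [h, one_mulVec]

end Reflections

/-! ### Two reflections make a rotation (Grover 1996; BBHT 1998, §3; BHMT 2002, §2) -/

section Rotation

variable {ι : Type*} [Fintype ι]

/-- **One Grover/amplitude-amplification step is a rotation by `2θ`** in the plane of
`g` ("good") and `b` ("bad"): with `ψ = sin θ · g + cos θ · b`, `⟨g, g⟩ = 1`, `⟨g, b⟩ = 0` and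
`cos θ · ⟨b, b⟩ = cos θ`, negating the `g`-component of `sin φ · g + cos φ · b` and then reflecting
about `ψ` gives `sin(φ + 2θ) · g + cos(φ + 2θ) · b`. [folklore] -/
theorem reflect_rotate (g b : ι → ℂ) (θ φ : ℝ) (hg : star g ⬝ᵥ g = 1) (hgb : star g ⬝ᵥ b = 0)
    (hb : (Real.cos θ : ℂ) * (star b ⬝ᵥ b) = Real.cos θ) :
    (2 * (star ((Real.sin θ : ℂ) • g + (Real.cos θ : ℂ) • b) ⬝ᵥ
        ((-(Real.sin φ : ℂ)) • g + (Real.cos φ : ℂ) • b))) •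
          ((Real.sin θ : ℂ) • g + (Real.cos θ : ℂ) • b) -
        ((-(Real.sin φ : ℂ)) • g + (Real.cos φ : ℂ) • b) =
      (Real.sin (φ + 2 * θ) : ℂ) • g + (Real.cos (φ + 2 * θ) : ℂ) • b := by
  have hbg : star b ⬝ᵥ g = 0 := by rw [star_dotProduct, hgb, star_zero]
  have hinner : star ((Real.sin θ : ℂ) • g + (Real.cos θ : ℂ) • b) ⬝ᵥ
      ((-(Real.sin φ : ℂ)) • g + (Real.cos φ : ℂ) • b) = (Real.cos (φ + θ) : ℂ) := by
    simp only [star_add, star_smul, add_dotProduct, smul_dotProduct, dotProduct_add,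
      dotProduct_smul, hg, hgb, hbg, Complex.star_def, Complex.conj_ofReal, smul_eq_mul,
      mul_zero, mul_one, add_zero, zero_add, Real.cos_add]
    have hb' := hb
    push_cast at hb' ⊢
    linear_combination (Complex.cos (φ : ℂ)) * hb'
  rw [hinner]
  have hpyth : (Complex.sin (θ : ℂ)) ^ 2 + (Complex.cos (θ : ℂ)) ^ 2 = 1 :=
    Complex.sin_sq_add_cos_sq _
  funext i
  simp only [Pi.add_apply, Pi.sub_apply, Pi.smul_apply, smul_eq_mul, Real.sin_add, Real.cos_add,
    Real.sin_two_mul, Real.cos_two_mul]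
  push_cast
  linear_combination (-2 * Complex.sin (φ : ℂ) * g i) * hpyth

/-- **Iterating the two reflections**: if `S` negates the `g`-component on the plane of `g, b`
and `R v = 2⟨ψ, v⟩ψ − v` with `ψ = sin θ · g + cos θ · b`, then
`(R ∘ S)^j ψ = sin((2j+1)θ) · g + cos((2j+1)θ) · b` (BBHT's closed formula
`k_j = sin((2j+1)θ)`). [folklore] -/
theorem reflect_rotate_iterate (g b : ι → ℂ) (θ : ℝ) (hg : star g ⬝ᵥ g = 1) (hgb : star g ⬝ᵥ b = 0)
    (hb : (Real.cos θ : ℂ) * (star b ⬝ᵥ b) = Real.cos θ) (S R : (ι → ℂ) → ι → ℂ)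
    (hS : ∀ α β : ℂ, S (α • g + β • b) = (-α) • g + β • b)
    (hR : ∀ v, R v = (2 * (star ((Real.sin θ : ℂ) • g + (Real.cos θ : ℂ) • b) ⬝ᵥ v)) •
      ((Real.sin θ : ℂ) • g + (Real.cos θ : ℂ) • b) - v) (j : ℕ) :
    (R ∘ S)^[j] ((Real.sin θ : ℂ) • g + (Real.cos θ : ℂ) • b) =
      (Real.sin ((2 * j + 1) * θ) : ℂ) • g + (Real.cos ((2 * j + 1) * θ) : ℂ) • b := by
  induction j with
  | zero => simp
  | succ j ih =>
    rw [Function.iterate_succ_apply', ih, Function.comp_apply, hS, hR, reflect_rotate g b θ _ hg hgb hb]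
    have h : (2 * (j : ℝ) + 1) * θ + 2 * θ = (2 * ((j + 1 : ℕ) : ℝ) + 1) * θ := by push_cast; ring
    rw [h]

end Rotation

/-! ### Coherent mixtures of programs (a coin register in the workspace) -/

section Mixture

variable {N : ℕ} {W' : Type} [Fintype W'] [DecidableEq W'] {K : Type} [Fintype K] [DecidableEq K]

/-- The basis `Fin N × Bool × (W' × K)` as (branch basis) × (coin). [folklore] -/
def mixEquiv (N : ℕ) (W' K : Type) : Fin N × Bool × (W' × K) ≃ (Fin N × Bool × W') × K where
  toFun σ := ((σ.1, σ.2.1, σ.2.2.1), σ.2.2.2)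
  invFun p := (p.1.1, p.1.2.1, (p.1.2.2, p.2))
  left_inv := fun _ => rfl
  right_inv := fun _ => rfl

/-- Placing a family of branch states side by side (branch `k` in block `k`). [folklore] -/
def liftVec (v : K → Fin N × Bool × W' → ℂ) : Fin N × Bool × (W' × K) → ℂ :=
  fun σ => v σ.2.2.2 (σ.1, σ.2.1, σ.2.2.1)

omit [Fintype W'] [DecidableEq W'] [Fintype K] [DecidableEq K] in
/-- Unfolding `liftVec`. [folklore] -/
@[simp] theorem liftVec_apply (v : K → Fin N × Bool × W' → ℂ) (i : Fin N) (b : Bool) (w : W') (k : K) :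
    liftVec v (i, b, (w, k)) = v k (i, b, w) := rfl

/-- The block-diagonal ("controlled on the coin") matrix of a family of branch matrices. [folklore] -/
def bdM (M : K → Matrix (Fin N × Bool × W') (Fin N × Bool × W') ℂ) :
    Matrix (Fin N × Bool × (W' × K)) (Fin N × Bool × (W' × K)) ℂ :=
  (blockDiagonal M).submatrix (mixEquiv N W' K) (mixEquiv N W' K)

omit [Fintype W'] [DecidableEq W'] [Fintype K] in
/-- Entries of the block-diagonal matrix. [folklore] -/
theorem bdM_apply (M : K → Matrix (Fin N × Bool × W') (Fin N × Bool × W') ℂ)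
    (i i' : Fin N) (b b' : Bool) (w w' : W') (k k' : K) :
    bdM M (i, b, (w, k)) (i', b', (w', k')) = if k = k' then M k (i, b, w) (i', b', w') else 0 := by
  simp [bdM, mixEquiv, blockDiagonal_apply']

/-- Block-diagonal matrices of unitaries are unitary. [folklore] -/
theorem blockDiagonal_mem_unitaryGroup {M : K → Matrix (Fin N × Bool × W') (Fin N × Bool × W') ℂ}
    (hM : ∀ k, M k ∈ Matrix.unitaryGroup (Fin N × Bool × W') ℂ) :
    blockDiagonal M ∈ Matrix.unitaryGroup ((Fin N × Bool × W') × K) ℂ := by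
  refine Matrix.mem_unitaryGroup_iff'.2 ?_
  rw [star_eq_conjTranspose, blockDiagonal_conjTranspose, ← blockDiagonal_mul]
  have h1 : (fun k => (M k)ᴴ * M k) = (1 : K → Matrix (Fin N × Bool × W') (Fin N × Bool × W') ℂ) := by
    funext k
    rw [Pi.one_apply, ← star_eq_conjTranspose]
    exact Matrix.mem_unitaryGroup_iff'.1 (hM k)
  show blockDiagonal (fun k => (M k)ᴴ * M k) = 1
  rw [h1, blockDiagonal_one]

/-- The reindexed block-diagonal matrix of unitaries is unitary. [folklore] -/
theorem bdM_mem_unitaryGroup {M : K → Matrix (Fin N × Bool × W') (Fin N × Bool × W') ℂ}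
    (hM : ∀ k, M k ∈ Matrix.unitaryGroup (Fin N × Bool × W') ℂ) :
    bdM M ∈ Matrix.unitaryGroup (Fin N × Bool × (W' × K)) ℂ :=
  submatrix_mem_unitaryGroup _ (blockDiagonal_mem_unitaryGroup hM)

/-- The controlled unitary `∑_k |k⟩⟨k| ⊗ U_k`. [folklore] -/
def bdU (U : K → Matrix.unitaryGroup (Fin N × Bool × W') ℂ) :
    Matrix.unitaryGroup (Fin N × Bool × (W' × K)) ℂ :=
  ⟨bdM fun k => ((U k : Matrix.unitaryGroup (Fin N × Bool × W') ℂ) :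
      Matrix (Fin N × Bool × W') (Fin N × Bool × W') ℂ),
    bdM_mem_unitaryGroup fun k => (U k).2⟩

/-- Unfolding `bdU`. [folklore] -/
@[simp] theorem bdU_val (U : K → Matrix.unitaryGroup (Fin N × Bool × W') ℂ) :
    ((bdU U : Matrix.unitaryGroup (Fin N × Bool × (W' × K)) ℂ) :
        Matrix (Fin N × Bool × (W' × K)) (Fin N × Bool × (W' × K)) ℂ) =
      bdM fun k => (U k : Matrix (Fin N × Bool × W') (Fin N × Bool × W') ℂ) := rfl

omit [DecidableEq W'] in
/-- `blockDiagonal M` acts blockwise on vectors. [folklore] -/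
theorem blockDiagonal_mulVec_apply (M : K → Matrix (Fin N × Bool × W') (Fin N × Bool × W') ℂ)
    (u : (Fin N × Bool × W') × K → ℂ) (s : Fin N × Bool × W') (k : K) :
    (blockDiagonal M *ᵥ u) (s, k) = (M k *ᵥ fun s' => u (s', k)) s := by
  simp only [mulVec, dotProduct]
  rw [Fintype.sum_prod_type]
  simp only [blockDiagonal_apply', ite_mul, zero_mul, Finset.sum_ite_eq, Finset.mem_univ, if_true]

omit [DecidableEq W'] in
/-- Block-diagonal matrices act blockwise. [folklore] -/
theorem bdM_mulVec_liftVec (M : K → Matrix (Fin N × Bool × W') (Fin N × Bool × W') ℂ)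
    (v : K → Fin N × Bool × W' → ℂ) : bdM M *ᵥ liftVec v = liftVec fun k => M k *ᵥ v k := by
  unfold bdM
  rw [submatrix_mulVec_equiv]
  funext ⟨i, b, w, k⟩
  simp only [Function.comp_apply, liftVec_apply]
  rw [show mixEquiv N W' K (i, b, w, k) = ((i, b, w), k) from rfl, blockDiagonal_mulVec_apply]
  rfl

omit [Fintype W'] [Fintype K] in
/-- The oracle on the big basis is the oracle on every block. [folklore] -/
theorem queryOracle_eq_bdM (x : Fin N → Bool) :
    queryOracle (W := W' × K) x = bdM fun _ => queryOracle (W := W') x := by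
  ext ⟨i, b, w, k⟩ ⟨i', b', w', k'⟩
  rw [bdM_apply, queryOracle_apply, queryOracle_apply]
  by_cases hk : k = k'
  · subst hk; simp
  · simp [hk]

/-- The coin preparation `1 ⊗ V` (acting on the coin register only). [folklore] -/
def prepM (V : Matrix K K ℂ) : Matrix (Fin N × Bool × (W' × K)) (Fin N × Bool × (W' × K)) ℂ :=
  ((1 : Matrix (Fin N × Bool × W') (Fin N × Bool × W') ℂ) ⊗ₖ V).submatrix
    (mixEquiv N W' K) (mixEquiv N W' K)

/-- The coin preparation is unitary when `V` is. [folklore] -/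
theorem prepM_mem_unitaryGroup {V : Matrix K K ℂ} (hV : V ∈ Matrix.unitaryGroup K ℂ) :
    prepM (N := N) (W' := W') V ∈ Matrix.unitaryGroup (Fin N × Bool × (W' × K)) ℂ := by
  have h : (1 : Matrix (Fin N × Bool × W') (Fin N × Bool × W') ℂ) ⊗ₖ V ∈
      Matrix.unitaryGroup ((Fin N × Bool × W') × K) ℂ :=
    Matrix.kronecker_mem_unitary (Submonoid.one_mem _) hV
  unfold prepM
  exact submatrix_mem_unitaryGroup (mixEquiv N W' K) h

/-- The coin preparation as a unitary. [folklore] -/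
def prepU (V : Matrix.unitaryGroup K ℂ) : Matrix.unitaryGroup (Fin N × Bool × (W' × K)) ℂ :=
  ⟨prepM (V : Matrix K K ℂ), prepM_mem_unitaryGroup V.2⟩

/-- Unfolding `prepU`. [folklore] -/
@[simp] theorem prepU_val (V : Matrix.unitaryGroup K ℂ) :
    ((prepU V : Matrix.unitaryGroup (Fin N × Bool × (W' × K)) ℂ) :
        Matrix (Fin N × Bool × (W' × K)) (Fin N × Bool × (W' × K)) ℂ) = prepM (V : Matrix K K ℂ) := rfl

/-- On the initial basis state the coin preparation spreads the amplitudes `V_{k k₀}` over the blocks. [folklore] -/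
theorem prepM_mulVec_single (V : Matrix K K ℂ) (s : Fin N × Bool × W') (k₀ : K) :
    prepM V *ᵥ Pi.single (s.1, s.2.1, (s.2.2, k₀)) (1 : ℂ) =
      liftVec fun k => V k k₀ • Pi.single s (1 : ℂ) := by
  funext ⟨i, b, w, k⟩
  rw [mulVec_single_one]
  simp only [col_apply, prepM, submatrix_apply, liftVec_apply, Pi.smul_apply, smul_eq_mul]
  rw [show mixEquiv N W' K (i, b, w, k) = ((i, b, w), k) from rfl,
    show mixEquiv N W' K (s.1, s.2.1, s.2.2, k₀) = (s, k₀) from rfl, kroneckerMap_apply, one_apply,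
    Pi.single_apply]
  split_ifs <;> simp

/-- A branch program in uniform shape: `U₀`, then `T` rounds (query, `U_{j+1}`). [folklore] -/
def brTok (p : Matrix.unitaryGroup (Fin N × Bool × W') ℂ)
    (st : ℕ → Matrix.unitaryGroup (Fin N × Bool × W') ℂ) (T : ℕ) : List (QTok N W') :=
  QTok.gate p :: (List.range T).flatMap fun j => [QTok.query, QTok.gate (st j)]

/-- The coherent mixture of a family of uniform-shape branch programs: prepare the coin, then
run every round controlled on the coin. [folklore] -/
def mixTok (V : Matrix.unitaryGroup K ℂ) (pre : K → Matrix.unitaryGroup (Fin N × Bool × W') ℂ)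
    (step : K → ℕ → Matrix.unitaryGroup (Fin N × Bool × W') ℂ) (T : ℕ) : List (QTok N (W' × K)) :=
  QTok.gate (prepU V) :: QTok.gate (bdU pre) ::
    (List.range T).flatMap fun j => [QTok.query, QTok.gate (bdU fun k => step k j)]

/-- A branch with one more round. [folklore] -/
theorem brTok_succ (p : Matrix.unitaryGroup (Fin N × Bool × W') ℂ)
    (st : ℕ → Matrix.unitaryGroup (Fin N × Bool × W') ℂ) (T : ℕ) :
    brTok p st (T + 1) = brTok p st T ++ [QTok.query, QTok.gate (st T)] := by
  simp [brTok, List.range_succ, List.flatMap_append]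

/-- A mixture with one more round. [folklore] -/
theorem mixTok_succ (V : Matrix.unitaryGroup K ℂ) (pre : K → Matrix.unitaryGroup (Fin N × Bool × W') ℂ)
    (step : K → ℕ → Matrix.unitaryGroup (Fin N × Bool × W') ℂ) (T : ℕ) :
    mixTok V pre step (T + 1) = mixTok V pre step T ++ [QTok.query, QTok.gate (bdU fun k => step k T)] := by
  simp [mixTok, List.range_succ, List.flatMap_append]

/-- A `T`-round branch makes `T` queries. [folklore] -/
theorem numQueries_brTok (p : Matrix.unitaryGroup (Fin N × Bool × W') ℂ)
    (st : ℕ → Matrix.unitaryGroup (Fin N × Bool × W') ℂ) (T : ℕ) : numQueries (brTok p st T) = T := by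
  induction T with
  | zero => rfl
  | succ T ih => rw [brTok_succ, numQueries_append, ih]; rfl

/-- A `T`-round mixture makes `T` queries. [folklore] -/
theorem numQueries_mixTok (V : Matrix.unitaryGroup K ℂ) (pre : K → Matrix.unitaryGroup (Fin N × Bool × W') ℂ)
    (step : K → ℕ → Matrix.unitaryGroup (Fin N × Bool × W') ℂ) (T : ℕ) :
    numQueries (mixTok V pre step T) = T := by
  induction T with
  | zero => rfl
  | succ T ih => rw [mixTok_succ, numQueries_append, ih]; rfl

/-- **The mixture runs every branch in its block**, with amplitude `V_{k k₀}`. [folklore] -/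
theorem runTok_mixTok (x : Fin N → Bool) (V : Matrix.unitaryGroup K ℂ)
    (pre : K → Matrix.unitaryGroup (Fin N × Bool × W') ℂ)
    (step : K → ℕ → Matrix.unitaryGroup (Fin N × Bool × W') ℂ) (T : ℕ) (s : Fin N × Bool × W') (k₀ : K) :
    runTok x (mixTok V pre step T) (Pi.single (s.1, s.2.1, (s.2.2, k₀)) 1) =
      liftVec fun k => ((V : Matrix K K ℂ) k k₀) • runTok x (brTok (pre k) (step k) T) (Pi.single s 1) := by
  induction T with
  | zero =>
    simp only [mixTok, brTok, List.range_zero, List.flatMap_nil, runTok_cons, runTok_nil, QTok.mat,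
      bdU_val, prepU_val]
    rw [prepM_mulVec_single, bdM_mulVec_liftVec]
    simp [mulVec_smul]
  | succ T ih =>
    rw [mixTok_succ, runTok_append, ih]
    simp only [runTok_cons, runTok_nil, QTok.mat, bdU_val]
    rw [queryOracle_eq_bdM, bdM_mulVec_liftVec, bdM_mulVec_liftVec]
    congr 1
    funext k
    rw [brTok_succ, runTok_append]
    simp [QTok.mat, mulVec_smul]

/-- Weights of smultiples. [folklore] -/
theorem wt_smul {ι : Type*} [Fintype ι] (A : Set ι) (c : ℂ) (v : ι → ℂ) :
    wt A (c • v) = ‖c‖ ^ 2 * wt A v := by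
  unfold wt
  rw [Finset.mul_sum]
  refine Finset.sum_congr rfl fun s _ => ?_
  simp [mul_pow]

/-- Weights are nonnegative. [folklore] -/
theorem wt_nonneg {ι : Type*} [Fintype ι] (A : Set ι) (v : ι → ℂ) : 0 ≤ wt A v :=
  Finset.sum_nonneg fun _ _ => by positivity

omit [DecidableEq W'] [DecidableEq K] in
/-- The weight of a blockwise set in a blockwise state is the sum of the branch weights. [folklore] -/
theorem wt_liftVec (A : K → Set (Fin N × Bool × W')) (v : K → Fin N × Bool × W' → ℂ) :
    wt {σ : Fin N × Bool × (W' × K) | (σ.1, σ.2.1, σ.2.2.1) ∈ A σ.2.2.2} (liftVec v) =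
      ∑ k, wt (A k) (v k) := by
  classical
  unfold wt
  rw [Finset.sum_filter]
  refine (Fintype.sum_equiv (mixEquiv N W' K) _
    (fun p => if p.1 ∈ A p.2 then ‖v p.2 p.1‖ ^ 2 else 0) fun σ => rfl).trans ?_
  rw [Fintype.sum_prod_type, Finset.sum_comm]
  refine Finset.sum_congr rfl fun k _ => ?_
  rw [Finset.sum_filter]

end Mixture

/-! ### Amplitude amplification of a program (BHMT 2002, §2, with the basis-state oracle `S_χ`) -/

section Amplify

variable {N : ℕ} {W : Type} [Fintype W] [DecidableEq W]

/-- Coordinate projection onto the basis states satisfying `P`. [folklore] -/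
def proj {ι : Type*} (P : ι → Prop) [DecidablePred P] (v : ι → ℂ) : ι → ℂ := fun σ => if P σ then v σ else 0

/-- `Π_P v + Π_{¬P} v = v`. [folklore] -/
theorem proj_add_proj_not {ι : Type*} (P : ι → Prop) [DecidablePred P] (v : ι → ℂ) :
    proj P v + proj (fun σ => ¬P σ) v = v := by
  funext σ; by_cases h : P σ <;> simp [proj, h]

/-- `⟨v, v⟩ = ∑ |v σ|²`. [folklore] -/
theorem star_dotProduct_self_eq {ι : Type*} [Fintype ι] (v : ι → ℂ) :
    star v ⬝ᵥ v = ((∑ σ, ‖v σ‖ ^ 2 : ℝ) : ℂ) := by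
  rw [Complex.ofReal_sum]
  simp only [dotProduct, Pi.star_apply, Complex.star_def, Complex.conj_mul']
  push_cast
  rfl

/-- The `P`-weight is `‖Π_P v‖²`. [folklore] -/
theorem wt_eq_sum_proj {ι : Type*} [Fintype ι] (P : ι → Prop) [DecidablePred P] (v : ι → ℂ) :
    wt {σ | P σ} v = ∑ σ, ‖proj P v σ‖ ^ 2 := by
  classical
  unfold wt
  rw [Finset.sum_filter]
  refine Finset.sum_congr rfl fun σ _ => ?_
  simp only [Set.mem_setOf_eq, proj]
  split_ifs <;> simp

/-- `⟨Π_P v, Π_P v⟩` is the `P`-weight. [folklore] -/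
theorem star_proj_dotProduct_proj {ι : Type*} [Fintype ι] (P : ι → Prop) [DecidablePred P] (v : ι → ℂ) :
    star (proj P v) ⬝ᵥ proj P v = ((wt {σ | P σ} v : ℝ) : ℂ) := by
  rw [star_dotProduct_self_eq, wt_eq_sum_proj]

/-- `Π_P v ⊥ Π_{¬P} w`. [folklore] -/
theorem star_proj_dotProduct_proj_not {ι : Type*} [Fintype ι] (P : ι → Prop) [DecidablePred P] (v w : ι → ℂ) :
    star (proj P v) ⬝ᵥ proj (fun σ => ¬P σ) w = 0 := by
  simp only [dotProduct, Pi.star_apply, proj]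
  exact Finset.sum_eq_zero fun σ _ => by by_cases h : P σ <;> simp [h]

/-- `‖Π_P v‖² + ‖Π_{¬P} v‖² = ‖v‖²`. [folklore] -/
theorem wt_add_wt_not {ι : Type*} [Fintype ι] (P : ι → Prop) [DecidablePred P] (v : ι → ℂ) :
    wt {σ | P σ} v + wt {σ | ¬P σ} v = ∑ σ, ‖v σ‖ ^ 2 := by
  classical
  unfold wt
  rw [Finset.sum_filter, Finset.sum_filter, ← Finset.sum_add_distrib]
  refine Finset.sum_congr rfl fun σ _ => ?_
  simp only [Set.mem_setOf_eq]
  split_ifs <;> simp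

/-- The `P`-weight of a vector in the plane of `proj P ψ` and `proj ¬P ψ`. [folklore] -/
theorem wt_plane {ι : Type*} [Fintype ι] (P : ι → Prop) [DecidablePred P] (ψ : ι → ℂ) (α β c c' : ℂ) :
    wt {σ | P σ} (α • (c • proj P ψ) + β • (c' • proj (fun σ => ¬P σ) ψ)) =
      ‖α‖ ^ 2 * (‖c‖ ^ 2 * wt {σ | P σ} ψ) := by
  rw [wt_eq_sum_proj, wt_eq_sum_proj, Finset.mul_sum, Finset.mul_sum]
  refine Finset.sum_congr rfl fun σ _ => ?_
  simp only [proj, Pi.add_apply, Pi.smul_apply, smul_eq_mul]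
  by_cases h : P σ
  · simp [h, mul_pow]
  · simp [h]

/-- `S_P` negates the `Π_P ψ`-component on the plane of `Π_P ψ`, `Π_{¬P} ψ`. [cite: BrassardEtAl2002, §2 Lemma 1] -/
theorem signGate_mulVec_plane {ι : Type*} [Fintype ι] [DecidableEq ι] (P : ι → Prop) [DecidablePred P]
    (ψ : ι → ℂ) (α β c c' : ℂ) :
    (signGate P : Matrix ι ι ℂ) *ᵥ (α • (c • proj P ψ) + β • (c' • proj (fun σ => ¬P σ) ψ)) =
      (-α) • (c • proj P ψ) + β • (c' • proj (fun σ => ¬P σ) ψ) := by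
  rw [signGate_mulVec]
  funext σ
  simp only [proj, Pi.add_apply, Pi.smul_apply, smul_eq_mul]
  by_cases h : P σ <;> simp [h]

/-- One round of amplitude amplification of the program `l` with respect to the basis states
satisfying `P`: `Q = 𝒜 S'_s 𝒜⁻¹ S_P` (BHMT's `Q = −𝒜 S_0 𝒜⁻¹ S_χ`). [cite: BrassardEtAl2002, §2] -/
def aaRound (l : List (QTok N W)) (s : Fin N × Bool × W) (P : Fin N × Bool × W → Prop) [DecidablePred P] :
    List (QTok N W) :=
  [QTok.gate (signGate P)] ++ invTok l ++ [QTok.gate (reflBasis s)] ++ l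

/-- One amplification round costs `2 · numQueries l` queries. [cite: BrassardEtAl2002, §2] -/
theorem numQueries_aaRound (l : List (QTok N W)) (s : Fin N × Bool × W) (P : Fin N × Bool × W → Prop)
    [DecidablePred P] : numQueries (aaRound l s P) = 2 * numQueries l := by
  simp only [aaRound, numQueries_append, numQueries_invTok, numQueries]
  ring

/-- Running one amplification round. [cite: BrassardEtAl2002, §2] -/
theorem runTok_aaRound (x : Fin N → Bool) (l : List (QTok N W)) (s : Fin N × Bool × W)
    (P : Fin N × Bool × W → Prop) [DecidablePred P] (v : Fin N × Bool × W → ℂ) :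
    runTok x (aaRound l s P) v =
      runTok x l ((reflBasis s : Matrix _ _ ℂ) *ᵥ runTok x (invTok l) ((signGate P : Matrix _ _ ℂ) *ᵥ v)) := by
  simp [aaRound, runTok_append, QTok.mat]

/-- Iterated rounds appended to a program. [folklore] -/
def iterTok (l G : List (QTok N W)) (j : ℕ) : List (QTok N W) := l ++ (List.replicate j G).flatten

/-- Running `l` followed by `j` copies of `G` is `(run G)^j ∘ run l`. [folklore] -/
theorem runTok_iterTok (x : Fin N → Bool) (l G : List (QTok N W)) (j : ℕ) (v : Fin N × Bool × W → ℂ) :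
    runTok x (iterTok l G j) v = (runTok x G)^[j] (runTok x l v) := by
  unfold iterTok
  rw [runTok_append]
  induction j generalizing v with
  | zero => simp
  | succ j ih =>
    rw [List.replicate_succ, List.flatten_cons, runTok_append, Function.iterate_succ_apply]
    have := ih (runTok x (invTok l) (runTok x G (runTok x l v)))
    rw [runTok_runTok_invTok] at this
    exact this

/-- Query count of `l` followed by `j` copies of `G`. [folklore] -/
theorem numQueries_iterTok (l G : List (QTok N W)) (j : ℕ) :
    numQueries (iterTok l G j) = numQueries l + j * numQueries G := by
  unfold iterTok
  rw [numQueries_append]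
  congr 1
  induction j with
  | zero => simp [numQueries]
  | succ j ih => rw [List.replicate_succ, List.flatten_cons, numQueries_append, ih]; ring

/-- **Amplitude amplification** (BHMT 2002, Thm 2 / BBHT §3 with a general preparation): if the
program `l` prepares from `e_s` a state of `P`-weight `a ∈ (0, 1)`, then after `j` rounds
`Q = 𝒜 S'_s 𝒜⁻¹ S_P` the `P`-weight is `sin²((2j+1)θ_a)`, `sin θ_a = √a`. [cite: BrassardEtAl2002, §2 eq. (8)] -/
theorem wt_aa_iterate (x : Fin N → Bool) (l : List (QTok N W)) (s : Fin N × Bool × W)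
    (P : Fin N × Bool × W → Prop) [DecidablePred P]
    (ha0 : 0 < wt {σ | P σ} (runTok x l (Pi.single s 1)))
    (ha1 : wt {σ | P σ} (runTok x l (Pi.single s 1)) < 1) (j : ℕ) :
    wt {σ | P σ} ((runTok x (aaRound l s P))^[j] (runTok x l (Pi.single s 1))) =
      Real.sin ((2 * j + 1) * Real.arcsin (Real.sqrt (wt {σ | P σ} (runTok x l (Pi.single s 1))))) ^ 2 := by
  set ψ := runTok x l (Pi.single s 1) with hψ_def
  set a := wt {σ | P σ} ψ with ha_def
  set θ := Real.arcsin (Real.sqrt a) with hθ_def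
  have hsin : Real.sin θ = Real.sqrt a :=
    Real.sin_arcsin (by linarith [Real.sqrt_nonneg a]) ((Real.sqrt_le_one).2 ha1.le)
  have hcos : Real.cos θ = Real.sqrt (1 - a) := by rw [hθ_def, Real.cos_arcsin, Real.sq_sqrt ha0.le]
  have hnorm : ∑ σ, ‖ψ σ‖ ^ 2 = 1 := by
    rw [hψ_def, sum_norm_sq_runTok, Finset.sum_eq_single s] <;> simp +contextual
  have hwtN : wt {σ | ¬P σ} ψ = 1 - a := by
    have := wt_add_wt_not P ψ; linarith
  set g : Fin N × Bool × W → ℂ := (((Real.sqrt a)⁻¹ : ℝ) : ℂ) • proj P ψ with hg_def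
  set b : Fin N × Bool × W → ℂ := (((Real.sqrt (1 - a))⁻¹ : ℝ) : ℂ) • proj (fun σ => ¬P σ) ψ with hb_def
  have hsa : Real.sqrt a ≠ 0 := Real.sqrt_ne_zero'.2 ha0
  have hsb : Real.sqrt (1 - a) ≠ 0 := Real.sqrt_ne_zero'.2 (by linarith)
  have hg : star g ⬝ᵥ g = 1 := by
    rw [hg_def, star_smul, smul_dotProduct, dotProduct_smul, star_proj_dotProduct_proj, ← ha_def,
      Complex.star_def, Complex.conj_ofReal, smul_eq_mul, smul_eq_mul, ← Complex.ofReal_mul,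
      ← Complex.ofReal_mul]
    have : (Real.sqrt a)⁻¹ * ((Real.sqrt a)⁻¹ * a) = 1 := by
      rw [← mul_assoc, ← mul_inv, Real.mul_self_sqrt ha0.le, inv_mul_cancel₀ ha0.ne']
    rw [this]; simp
  have hgb : star g ⬝ᵥ b = 0 := by
    rw [hg_def, hb_def, star_smul, smul_dotProduct, dotProduct_smul, star_proj_dotProduct_proj_not]
    simp
  have hbb : star b ⬝ᵥ b = 1 := by
    rw [hb_def, star_smul, smul_dotProduct, dotProduct_smul, star_proj_dotProduct_proj, hwtN,
      Complex.star_def, Complex.conj_ofReal, smul_eq_mul, smul_eq_mul, ← Complex.ofReal_mul,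
      ← Complex.ofReal_mul]
    have : (Real.sqrt (1 - a))⁻¹ * ((Real.sqrt (1 - a))⁻¹ * (1 - a)) = 1 := by
      rw [← mul_assoc, ← mul_inv, Real.mul_self_sqrt (by linarith), inv_mul_cancel₀ (by linarith)]
    rw [this]; simp
  have hb : (Real.cos θ : ℂ) * (star b ⬝ᵥ b) = Real.cos θ := by rw [hbb, mul_one]
  have hψ : ψ = (Real.sin θ : ℂ) • g + (Real.cos θ : ℂ) • b := by
    rw [hsin, hcos, hg_def, hb_def, smul_smul, smul_smul, ← Complex.ofReal_mul, ← Complex.ofReal_mul,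
      mul_inv_cancel₀ hsa, mul_inv_cancel₀ hsb]
    simp [proj_add_proj_not]
  have hS : ∀ α β : ℂ, (signGate P : Matrix _ _ ℂ) *ᵥ (α • g + β • b) = (-α) • g + β • b :=
    fun α β => signGate_mulVec_plane P ψ α β _ _
  have hR : ∀ v, runTok x l ((reflBasis s : Matrix _ _ ℂ) *ᵥ runTok x (invTok l) v) =
      (2 * (star ((Real.sin θ : ℂ) • g + (Real.cos θ : ℂ) • b) ⬝ᵥ v)) •
        ((Real.sin θ : ℂ) • g + (Real.cos θ : ℂ) • b) - v := fun v => by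
    rw [← hψ, hψ_def]; exact runTok_reflBasis_invTok x l s v
  have hstep : runTok x (aaRound l s P) =
      (fun v => runTok x l ((reflBasis s : Matrix _ _ ℂ) *ᵥ runTok x (invTok l) v)) ∘
        fun v => (signGate P : Matrix _ _ ℂ) *ᵥ v := by
    funext v; exact runTok_aaRound x l s P v
  have key := reflect_rotate_iterate g b θ hg hgb hb (fun v => (signGate P : Matrix _ _ ℂ) *ᵥ v)
    (fun v => runTok x l ((reflBasis s : Matrix _ _ ℂ) *ᵥ runTok x (invTok l) v)) hS hR j
  rw [hstep, hψ, key, hg_def, hb_def, wt_plane, ← ha_def]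
  rw [Complex.norm_real, Complex.norm_real, Real.norm_eq_abs, Real.norm_eq_abs, sq_abs, sq_abs, inv_pow,
    Real.sq_sqrt ha0.le, inv_mul_cancel₀ ha0.ne', mul_one]

/-- If the prepared state has no `P`-weight, amplification does nothing. [cite: BrassardEtAl2002, §2] -/
theorem wt_aa_iterate_zero (x : Fin N → Bool) (l : List (QTok N W)) (s : Fin N × Bool × W)
    (P : Fin N × Bool × W → Prop) [DecidablePred P] (ha : wt {σ | P σ} (runTok x l (Pi.single s 1)) = 0)
    (j : ℕ) : wt {σ | P σ} ((runTok x (aaRound l s P))^[j] (runTok x l (Pi.single s 1))) = 0 := by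
  set ψ := runTok x l (Pi.single s 1) with hψ_def
  have hnorm : ∑ σ, ‖ψ σ‖ ^ 2 = 1 := by
    rw [hψ_def, sum_norm_sq_runTok, Finset.sum_eq_single s] <;> simp +contextual
  have hproj : proj P ψ = 0 := by
    have h := (wt_eq_sum_proj P ψ).symm.trans ha
    funext σ
    have := (Finset.sum_eq_zero_iff_of_nonneg (fun σ _ => sq_nonneg ‖proj P ψ σ‖)).1 h σ (Finset.mem_univ σ)
    exact norm_eq_zero.1 ((pow_eq_zero_iff (n := 2) (by norm_num)).1 this)
  have hS : (signGate P : Matrix _ _ ℂ) *ᵥ ψ = ψ := by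
    rw [signGate_mulVec]
    funext σ
    by_cases h : P σ
    · have := congrFun hproj σ
      simp only [proj, if_pos h, Pi.zero_apply] at this
      simp [h, this]
    · simp [h]
  have hR : runTok x l ((reflBasis s : Matrix _ _ ℂ) *ᵥ runTok x (invTok l) ψ) = ψ := by
    rw [hψ_def, runTok_reflBasis_invTok, ← hψ_def, star_dotProduct_self_eq, hnorm]
    simp [two_smul]
  have hfix : runTok x (aaRound l s P) ψ = ψ := by rw [runTok_aaRound, hS, hR]
  have hiter : ∀ j : ℕ, (runTok x (aaRound l s P))^[j] ψ = ψ := fun j =>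
    Function.iterate_fixed hfix j
  rw [hiter, ha]

end Amplify

end Literature.Computability.QuantumComplexity.QProg

end
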